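import Literature.NumberTheory.EllipticCurves.IsogenyQuotientCurveProofs
import Literature.NumberTheory.EllipticCurves.IsogenySeparableFactorProofs
import Literature.NumberTheory.EllipticCurves.RationalIsogenyDegreesProofs
import HarnessLib

/-!
# Crux `MazurMCOnX1RankZero` (item stmt-BirchSwinnertonDyer-19035), line `interlude_with_torsion`, road B (B2):
# a CYCLIC `ℚ`-isogeny of degree `≠ 1` factors over `ℚ` through an isogeny of PRIME degree

Cell `bsd-eis` (host `run/shared/lean/pub/bsd-eis/`), LEAD `cruxlead-19035` (g0); `--supports`
stmt-BirchSwinnertonDyer-19035 as a HELPER. Content = `cyclicIsogenyFactorsThroughPrime_holds` of the bsd-idea-11 supplement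
line `Cruxes/MazurMCOnX1RankZero/Lines/interlude_stepsTwoThree_split_idea11g6.lean` (REV 8.4, mathematics by seat
bsd-idea-11 g15, kernel-checked there), moved verbatim into the tree with its statement unfolded. Isogeny algebra
(Silverman AEC III.4), UNCONDITIONAL; NOTHING is asserted about BSD, Mazur's main conjecture or IMC2. Used by road B of the
line to reduce «finite Selmer kernel along one cyclic `ℚ`-isogeny» to the case of ONE `ℚ`-isogeny of prime degree, by
strong induction on the degree.

WHAT (`exists_prime_degree_factor_of_isCyclic`). For elliptic `W, W'` over `ℚ` and a cyclic isogeny `ψ : W → W'`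
(`Isogeny.IsCyclic`) of degree `≠ 1`, there are an elliptic `W₁/ℚ`, an isogeny `g : W → W₁` of PRIME degree and a cyclic
isogeny `λ : W₁ → W'` of degree `< deg ψ` with `ψ = λ ∘ g` on `ℚ̄`-points. Proof: a generator `P` of `ker ψ` (order
`N = deg ψ`); a prime `ℓ ∣ N`; `S = ℤ·(N/ℓ)P` has order `ℓ` and is `Γ_ℚ`-stable (every `σ` acts on `ℤP = ker ψ`);
`g : W → W/S` is the tree's quotient isogeny (`exists_isogeny_ker_eq_and_comp_eq_nsmul_holds`, `deg g = #S = ℓ`);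
`ψ = λ ∘ g` by AEC III.4.11 (`Isogeny.exists_eq_comp_of_ker_le_of_isSeparable`, separability from characteristic `0`);
`ker λ = ℤ·g(P)` has order `≤ N/ℓ < N`. -- TODO(general form): any perfect base field in place of `ℚ`.
References: Silverman, AEC Prop. III.4.12, Rem. III.4.13.2, Cor. III.4.11, Thm. III.4.10(c).
-/

set_option linter.dupNamespace false
set_option autoImplicit false

noncomputable section

open scoped Classical

open WeierstrassCurve Literature.NumberTheory.EllipticCurves Literature.NumberTheory.GaloisRepresentations

namespace Summit.BirchSwinnertonDyer.BirchSwinnertonDyer.Theorems.InterludeWithTorsion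

/-- **A cyclic `ℚ`-isogeny of degree `≠ 1` factors through an isogeny of prime degree**: `ψ = λ ∘ g` with `deg g`
prime, `λ` cyclic and `deg λ < deg ψ`. `P` a generator of `W[ψ]` (order `N`), prime `ℓ ∣ N`, `S = ℤ·(N/ℓ)P` (order
`ℓ`, `Γ_ℚ`-stable); `g : W → W/S` the tree's quotient isogeny (degree `#S = ℓ`); `ψ = λ ∘ g` (AEC III.4.11, `g`
separable in characteristic `0`); `ker λ = ℤ·gP`, of order `≤ N/ℓ < N`.
[cite: SilvermanAEC2009, Prop. III.4.12, Rem. III.4.13.2, Cor. III.4.11, Thm. III.4.10(c)] -/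
theorem exists_prime_degree_factor_of_isCyclic :
    ∀ (W W' : WeierstrassCurve ℚ) [W.IsElliptic] [W'.IsElliptic] (ψ : Isogeny W W'),
      ψ.IsCyclic → ψ.degree ≠ 1 →
      ∃ (W₁ : WeierstrassCurve ℚ) (_ : W₁.IsElliptic) (g : Isogeny W W₁) (lam : Isogeny W₁ W'),
        g.degree.Prime ∧ lam.IsCyclic ∧ lam.degree < ψ.degree ∧ ∀ P, ψ P = lam (g P) := by
  intro W W' _ _ ψ hψ hdeg1
  -- Step 1: a generator `P` of `ker ψ`, of order `deg ψ`, with `Γ_ℚ`-stable `ℤP = ker ψ`.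
  haveI : IsAddCyclic ψ.toAddMonoidHom.ker := hψ
  obtain ⟨g₀, hg₀⟩ := IsAddCyclic.exists_ofOrder_eq_natCard (α := ψ.toAddMonoidHom.ker)
  set P : W.geomPoints := (g₀ : W.geomPoints) with hPdef
  have hordP : addOrderOf P = ψ.degree := by
    rw [hPdef, AddSubgroup.addOrderOf_coe, hg₀]
    rfl
  have hgen : AddSubgroup.zmultiples P = ψ.toAddMonoidHom.ker := by
    apply AddSubgroup.eq_of_le_of_card_ge (AddSubgroup.zmultiples_le_of_mem g₀.2)
    rw [Nat.card_zmultiples, hordP]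
    exact le_rfl
  have hP0 : ψ P = 0 := (AddMonoidHom.mem_ker).mp g₀.2
  have hstP : ∀ σ : Field.absoluteGaloisGroup ℚ, σ • P ∈ AddSubgroup.zmultiples P := fun σ ↦ by
    rw [hgen, AddMonoidHom.mem_ker, Isogeny.coe_toAddMonoidHom, ψ.map_smul, hP0, smul_zero]
  -- Step 2: a prime `ℓ ∣ deg ψ`; `Q = (deg ψ / ℓ) • P` has order `ℓ`; `S = ℤQ` is `Γ_ℚ`-stable.
  obtain ⟨ℓ, hℓ, hℓn⟩ := Nat.exists_prime_and_dvd hdeg1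
  have hn0 : ψ.degree ≠ 0 := ψ.degree_pos.ne'
  have hm0 : ψ.degree / ℓ ≠ 0 :=
    (Nat.div_pos (Nat.le_of_dvd ψ.degree_pos hℓn) hℓ.pos).ne'
  have hmn : ψ.degree / ℓ ∣ ψ.degree := Nat.div_dvd_of_dvd hℓn
  set Q : W.geomPoints := (ψ.degree / ℓ) • P with hQdef
  have hordQ : addOrderOf Q = ℓ := by
    rw [hQdef, addOrderOf_nsmul_of_dvd hm0 (by rw [hordP]; exact hmn), hordP]
    exact Nat.div_div_self hℓn hn0
  have hQmem : Q ∈ AddSubgroup.zmultiples P := by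
    rw [hQdef]
    exact AddSubgroup.nsmul_mem _ (AddSubgroup.mem_zmultiples P) _
  set S : AddSubgroup W.geomPoints := AddSubgroup.zmultiples Q with hSdef
  have hScard : Nat.card S = ℓ := by
    rw [hSdef, Nat.card_zmultiples, hordQ]
  haveI : Finite S := Nat.finite_of_card_ne_zero (by rw [hScard]; exact hℓ.ne_zero)
  have hSfin : (S : Set W.geomPoints).Finite := Set.toFinite _
  have hSleP : S ≤ AddSubgroup.zmultiples P := AddSubgroup.zmultiples_le_of_mem hQmem
  have hSstab : ∀ (σ : Field.absoluteGaloisGroup ℚ) (R : W.geomPoints), R ∈ S → σ • R ∈ S := by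
    intro σ R hR
    obtain ⟨k, rfl⟩ := AddSubgroup.mem_zmultiples_iff.mp hR
    obtain ⟨m, hm⟩ := AddSubgroup.mem_zmultiples_iff.mp (hstP σ)
    have hσQ : σ • Q = m • Q := by
      rw [hQdef, smul_comm σ (ψ.degree / ℓ) P, ← hm, smul_comm (ψ.degree / ℓ) m P]
    rw [smul_comm σ k Q, hσQ]
    exact S.zsmul_mem (S.zsmul_mem (AddSubgroup.mem_zmultiples Q) m) k
  -- Step 3: the quotient `W₁ = W/S` and `g : W → W₁` over `ℚ` with `ker g = S` (AEC III.4.12, 4.13.2).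
  obtain ⟨W₁, hW₁, g, -, hker, -, -⟩ :=
    W.exists_isogeny_ker_eq_and_comp_eq_nsmul_holds S hSfin hSstab
  have hker' : ∀ R : W.geomPoints, g R = 0 ↔ R ∈ S := fun R ↦ by
    rw [← hker, AddMonoidHom.mem_ker, Isogeny.coe_toAddMonoidHom]
  have hSle : ∀ R : W.geomPoints, g R = 0 → ψ R = 0 := by
    intro R hR
    have h := hSleP ((hker' R).mp hR)
    rw [hgen] at h
    exact (AddMonoidHom.mem_ker).mp h
  -- Step 4: `ψ = λ ∘ g` (AEC III.4.11; `g` separable in characteristic `0`).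
  haveI : FiniteDimensional g.pullbackField W.geomFunctionField :=
    Isogeny.finiteDimensional_pullbackField_holds W W₁ g
  haveI : CharZero W.geomFunctionField :=
    charZero_of_injective_ringHom (algebraMap ℚ W.geomFunctionField).injective
  haveI : CharZero g.pullbackField := (algebraMap g.pullbackField W.geomFunctionField).charZero
  haveI : Algebra.IsSeparable g.pullbackField W.geomFunctionField :=
    Algebra.IsAlgebraic.isSeparable_of_perfectField
  obtain ⟨lam, hlam⟩ := g.exists_eq_comp_of_ker_le_of_isSeparable ψ hSle
  -- Step 5: `ker λ = g(ker ψ) = ℤ(g P)`.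
  have hkerlam : lam.toAddMonoidHom.ker = AddSubgroup.zmultiples (g P) := by
    ext R
    rw [AddMonoidHom.mem_ker, Isogeny.coe_toAddMonoidHom]
    constructor
    · intro hR
      obtain ⟨T, rfl⟩ := g.surjective R
      have hT0 : ψ T = 0 := by rw [hlam T]; exact hR
      have hT : T ∈ AddSubgroup.zmultiples P := by
        rw [hgen]
        exact (AddMonoidHom.mem_ker).mpr hT0
      obtain ⟨k, rfl⟩ := AddSubgroup.mem_zmultiples_iff.mp hT
      rw [map_zsmul]
      exact AddSubgroup.zsmul_mem _ (AddSubgroup.mem_zmultiples _) k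
    · intro hR
      obtain ⟨k, rfl⟩ := AddSubgroup.mem_zmultiples_iff.mp hR
      rw [map_zsmul, ← hlam P, hP0, smul_zero]
  refine ⟨W₁, hW₁, g, lam, ?_, ?_, ?_, hlam⟩
  · -- `deg g = #S = ℓ`
    change (Nat.card g.toAddMonoidHom.ker).Prime
    rw [hker, hScard]
    exact hℓ
  · -- `λ` is cyclic
    change IsAddCyclic lam.toAddMonoidHom.ker
    rw [hkerlam]
    infer_instance
  · -- `deg λ = ord (g P) ≤ deg ψ / ℓ < deg ψ`
    change Nat.card lam.toAddMonoidHom.ker < ψ.degree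
    rw [hkerlam, Nat.card_zmultiples]
    have hmgP : (ψ.degree / ℓ) • g P = 0 := by
      rw [← map_nsmul]
      exact (hker' Q).mpr (AddSubgroup.mem_zmultiples Q)
    exact (addOrderOf_le_of_nsmul_eq_zero (Nat.pos_of_ne_zero hm0) hmgP).trans_lt
      (Nat.div_lt_self ψ.degree_pos hℓ.one_lt)

end Summit.BirchSwinnertonDyer.BirchSwinnertonDyer.Theorems.InterludeWithTorsion

end
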